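import Summits.FinalStateConjecture.FinalStateConjecture.Theorems.BartnikGapSettlingBondiBartnikRigidityKillingPropagationOfFacts
import Literature.Geometry.Lorentzian.CausalCurveEndpoint
import HarnessLib

/-!
# (H) PROVED: at an entry point of the Killing domain the causal past meets its closure only on the
# initial boundary — and the closer of β' `stub_killingPropagation'` modulo the two named facts and
# the bricks (G3), (G4); line `direct-method-on-the-cone`, crux `BondiBartnikRigidity`
# (stmt-FinalStateConjecture-10807); worker betaA of lead c3

The displayed hypothesis (H) of the conditional closer `stub_killingPropagation'_of_facts'`
(`…KillingPropagationOfFacts.lean`) is a THEOREM of the tree's causality theory after all — no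
generator structure of achronal boundaries is needed:

* `causalPast_inter_closure_subset_of_mem_initialBoundary` — if `z ∈ S = C ∪ N_out` is
  chronologically before a point `y` of `G = (killingDomain)°`, then `J⁻(z) ∩ closure G ⊆ S`:
  for `x ∈ J⁻(z) ∩ closure G ∖ S`, extend a timelike segment from `x` to `y` (`x ≤ z ≪ y`) to an
  endless timelike curve; as `y ∈ D⁺(S)` it meets `S` — not at `x`, not before `x` (then
  `z ∈ I⁺(S) ∩ S = ∅`, achronality of `S`), not after `x` at `n ≫ x` (the open `I⁻(n) ∋ x` meets
  `G ⊆ J⁺(S)`, so `n ∈ I⁺(S) ∩ S = ∅` by push-up);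
* `causalPast_inter_closure_subset_of_entry` — (H) itself: for an entry point `z` (past endpoint,
  outside `G`, of a future timelike curve on a nonempty interval running in `G`), `z ∈ S`
  (`mem_initialBoundary_of_entry`) and some point of the curve is `≫ z` (endpoint property);
* `stub_killingPropagation'_of_facts` — **β' from (G3), (G4) and the two named facts
  `fischerMarsdenMoncrief_killing_development`, `geroch1970_exists_isCauchyHypersurface` ONLY**
  (registered helper stub; β' = the registered signature of `stub_killingPropagation'` verbatim).

Everything is proved; no definitions, no named facts.  References: Hawking–Ellis 1973, §6.5
[HawkingEllis1973CUP]; O'Neill 1983, Ch. 14, Cor. 14.1, Lemma 14.2, Def. 14.28, Prop. 14.31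
[ONeillSemiRiemannian1983]; Moncrief 1975, §III [Moncrief1975].
-/

noncomputable section

-- D-0017: single-problem summit, `Summit.<S>.<S>.…` by design (cf. lakefile `weak.linter.dupNamespace`).
set_option linter.dupNamespace false
set_option maxSynthPendingDepth 3

open Set Filter Function Topology TopologicalSpace
open Literature.Geometry.Lorentzian
open scoped Manifold ContDiff Topology ENNReal

namespace Summit.FinalStateConjecture.FinalStateConjecture.Theorems.BondiBartnikRigidity.DirectMethod

namespace KillingPropagation

universe u

section Development

variable {X : Type u} [TopologicalSpace X] [ChartedSpace E3 X] [IsManifold (𝓡 3) ∞ X]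
  [ConnectedSpace X] {D : InitialDataSet (𝓡 3) X}

/-- **The causal past of a boundary point below the Killing domain meets its closure only on the
initial boundary.**  Let `z ∈ S = C ∪ N_out` be chronologically before a point `y` of
`G = (killingDomain)°` (e.g. `z` an entry point of `G`), and `x ∈ J⁻(z) ∩ closure G`.  Then
`x ∈ S`.  Otherwise extend a timelike segment from `x` to `y` (`x ≤ z ≪ y`, push-up) to an endless
timelike curve `Δ` (O'Neill 1983, Def. 14.28/Prop. 14.31); as `y ∈ D⁺(S)`, `Δ` meets `S`: not at
`x ∉ S`; not before `x` — then `x`, hence `z ∈ S`, would lie in `I⁺(S)`, against the achronality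
`I⁺(S) ∩ S = ∅` —; and not after `x` at a point `n ≫ x`: the open set `I⁻(n) ∋ x` meets `G ⊆ J⁺(S)`,
so `n ∈ I⁺(J⁺ S) = I⁺(S)` (O'Neill 1983, Cor. 14.1), again against achronality.
Hawking–Ellis 1973, §6.5. [cite: HawkingEllis1973CUP, §6.5] -/
theorem causalPast_inter_closure_subset_of_mem_initialBoundary (𝒱 : VacuumCauchyDevelopment D)
    (M : Fin 1 → ℝ) (p : 𝒱.carrier) (B : Fin 1 → ModelBackground)
    (Φ : ∀ i, (B i).domain → 𝒱.carrier) (hCX : collarCore M p B Φ ⊆ range 𝒱.embed)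
    {z y : 𝒱.carrier}
    (hzS : z ∈ collarCore M p B Φ ∪
      (frontier (𝒱.metric.causalFuture 𝒱.timeOrientation (collarCore M p B Φ)) ∩
        𝒱.metric.causalFuture 𝒱.timeOrientation (Φ 0 '' shellSlab (B 0) (M 0))))
    (hy : y ∈ interior (killingDomain 𝒱 M p B Φ))
    (hzy : y ∈ 𝒱.metric.chronologicalFuture 𝒱.timeOrientation {z}) :
    𝒱.metric.causalPast 𝒱.timeOrientation {z} ∩ closure (interior (killingDomain 𝒱 M p B Φ)) ⊆
      collarCore M p B Φ ∪
        (frontier (𝒱.metric.causalFuture 𝒱.timeOrientation (collarCore M p B Φ)) ∩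
          𝒱.metric.causalFuture 𝒱.timeOrientation (Φ 0 '' shellSlab (B 0) (M 0))) := by
  set g := 𝒱.metric
  set τ := 𝒱.timeOrientation
  set C := collarCore M p B Φ with hC
  set S : Set 𝒱.carrier := C ∪ (frontier (g.causalFuture τ C) ∩
    g.causalFuture τ (Φ 0 '' shellSlab (B 0) (M 0))) with hS
  set G : Set 𝒱.carrier := interior (killingDomain 𝒱 M p B Φ) with hG
  have hn2 : (2 : ℕ∞ω) ≤ ((⊤ : ℕ∞) : ℕ∞ω) := WithTop.coe_le_coe.mpr le_top
  have hn1 : (1 : ℕ∞ω) ≤ ((⊤ : ℕ∞) : ℕ∞ω) := le_trans one_le_two hn2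
  have hSach := chronologicalFuture_inter_initialBoundary_eq_empty 𝒱 M p B Φ hCX
  have hGJS : G ⊆ g.causalFuture τ S :=
    interior_subset.trans (futureDomain_subset_causalFuture 𝒱.toSpacetime S)
  intro x hx
  by_contra hxS
  obtain ⟨hxz, hxcl⟩ := hx
  -- `x ≤ z ≪ y`, so `x ≪ y`
  have hxy : y ∈ g.chronologicalFuture τ {x} :=
    LorentzianMetric.mem_chronologicalFuture_of_mem_causalFuture hn1
      (LorentzianMetric.mem_causalPast_singleton_iff.1 hxz) hzy
  -- the endless extension of a timelike segment from `x` to `y`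
  obtain ⟨x', hx', σ, a, b, hab, hσ, hσa, hσb⟩ := hxy
  rw [mem_singleton_iff] at hx'
  obtain ⟨Δ, Dm, hΔ, haD, hbD, hΔa, hΔb⟩ :=
    LorentzianMetric.exists_isEndlessTimelikeCurve_extends hn2 hab hσ
  rw [hσa, hx'] at hΔa
  rw [hσb] at hΔb
  have hyD : y ∈ killingDomain 𝒱 M p B Φ := interior_subset hy
  obtain ⟨t, htD, htb, htS⟩ := hyD Δ Dm hΔ.1 hΔ.2.1.isFutureCausalCurveOn hΔ.2.2.2 b hbD hΔb
  rcases lt_trichotomy t a with hta | rfl | hta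
  · -- before `x`: `Δ t ≪ x ≤ z`, so `z ∈ I⁺(S) ∩ S`
    have hxI : x ∈ g.chronologicalFuture τ S :=
      ⟨Δ t, htS, Δ, t, a, hta, hΔ.2.1.mono (hΔ.1.out htD haD), rfl, hΔa⟩
    have hzI : z ∈ g.chronologicalFuture τ S :=
      LorentzianMetric.mem_chronologicalFuture_of_mem_chronologicalFuture_of_mem_causalFuture_set hn1
        hxI (LorentzianMetric.mem_causalPast_singleton_iff.1 hxz)
    have : z ∈ g.chronologicalFuture τ S ∩ S := ⟨hzI, hzS⟩
    rw [hSach] at this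
    exact this
  · -- at `x`
    rw [hΔa] at htS
    exact hxS htS
  · -- after `x`: `n = Δ t ∈ S` with `x ≪ n`; the open set `I⁻(n) ∋ x` meets `G ⊆ J⁺(S)`
    have hxn : Δ t ∈ g.chronologicalFuture τ {x} :=
      ⟨x, rfl, Δ, a, t, hta, hΔ.2.1.mono (hΔ.1.out haD htD), hΔa, rfl⟩
    have hxn' : x ∈ g.chronologicalPast τ {Δ t} :=
      LorentzianMetric.mem_chronologicalPast_of_mem_chronologicalFuture hxn
    obtain ⟨w, hwP, hwG⟩ := mem_closure_iff_nhds.mp hxcl _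
      ((LorentzianMetric.isOpen_chronologicalPast_of_boundaryless g τ {Δ t}).mem_nhds hxn')
    have hwJ : w ∈ g.causalFuture τ S := hGJS hwG
    rw [LorentzianMetric.causalFuture_eq_biUnion] at hwJ
    simp only [mem_iUnion, exists_prop] at hwJ
    obtain ⟨s', hs'S, hws'⟩ := hwJ
    have hnI : Δ t ∈ g.chronologicalFuture τ S :=
      LorentzianMetric.chronologicalFuture_mono (singleton_subset_iff.2 hs'S)
        (LorentzianMetric.mem_chronologicalFuture_of_mem_causalFuture hn1 hws'
          (LorentzianMetric.mem_chronologicalFuture_of_mem_chronologicalPast hwP))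
    have : Δ t ∈ g.chronologicalFuture τ S ∩ S := ⟨hnI, htS⟩
    rw [hSach] at this
    exact this

/-- **(H) holds: at an entry point of the Killing domain the causal past meets the closure of the
Killing domain only on the initial boundary.**  For a future timelike curve `γ` on a nonempty
interval `s` running in `G = (killingDomain)°` with past endpoint `z ∉ G`: `z ∈ closure G`, some
`γ t₀ ≫ z` (endpoint property, O'Neill 1983, Lemma 14.2 / Cor. 14.1), `z ∈ S` by
`mem_initialBoundary_of_entry`, and `causalPast_inter_closure_subset_of_mem_initialBoundary` applies.
[cite: HawkingEllis1973CUP, §6.5] -/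
theorem causalPast_inter_closure_subset_of_entry (𝒱 : VacuumCauchyDevelopment D)
    (M : Fin 1 → ℝ) (p : 𝒱.carrier) (B : Fin 1 → ModelBackground)
    (Φ : ∀ i, (B i).domain → 𝒱.carrier) (hCX : collarCore M p B Φ ⊆ range 𝒱.embed)
    {γ : ℝ → 𝒱.carrier} {s : Set ℝ} {z : 𝒱.carrier} (hs : s.OrdConnected) (hne : s.Nonempty)
    (hγ : 𝒱.metric.IsFutureTimelikeCurveOn 𝒱.timeOrientation γ s)
    (hγG : ∀ t ∈ s, γ t ∈ interior (killingDomain 𝒱 M p B Φ)) (hz : HasPastEndpoint γ s z)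
    (hzG : z ∉ interior (killingDomain 𝒱 M p B Φ)) :
    𝒱.metric.causalPast 𝒱.timeOrientation {z} ∩ closure (interior (killingDomain 𝒱 M p B Φ)) ⊆
      collarCore M p B Φ ∪
        (frontier (𝒱.metric.causalFuture 𝒱.timeOrientation (collarCore M p B Φ)) ∩
          𝒱.metric.causalFuture 𝒱.timeOrientation (Φ 0 '' shellSlab (B 0) (M 0))) := by
  set g := 𝒱.metric
  set τ := 𝒱.timeOrientation
  have hn1 : (1 : ℕ∞ω) ≤ ((⊤ : ℕ∞) : ℕ∞ω) := le_trans one_le_two (WithTop.coe_le_coe.mpr le_top)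
  obtain ⟨t₀, ht₀⟩ := hne
  have hzcl : z ∈ closure (interior (killingDomain 𝒱 M p B Φ)) := hz.mem_closure ⟨t₀, ht₀⟩ hγG
  -- a second parameter below `t₀`: otherwise `z = γ t₀ ∈ G`
  obtain ⟨t₁, ht₁, ht₁₀⟩ : ∃ t₁ ∈ s, t₁ < t₀ := by
    by_contra h
    push Not at h
    haveI : Nonempty s := ⟨⟨t₀, ht₀⟩⟩
    have h1 : HasPastEndpoint γ s (γ t₀) := hasPastEndpoint_of_isLeast ⟨ht₀, h⟩
    have : z = γ t₀ := tendsto_nhds_unique hz h1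
    exact hzG (this ▸ hγG t₀ ht₀)
  -- the endpoint property: `z ≪ γ t₀`
  have hzy : γ t₀ ∈ g.chronologicalFuture τ {z} := by
    haveI : g.HasLeviCivita := g.toPseudoRiemannianMetric.hasLeviCivita
    haveI : Fact ((1 : ℕ∞ω) ≤ ((⊤ : ℕ∞) : ℕ∞ω)) := ⟨hn1⟩
    haveI : CovariantDerivative.ContMDiffCovariantDerivative g.leviCivita 1 :=
      ⟨g.toPseudoRiemannianMetric.isLocallyContMDiff_leviCivita_holds 1
        (by rw [show ((1 : ℕ∞) : ℕ∞ω) + 1 = 2 by norm_num]; exact WithTop.coe_le_coe.2 le_top)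
        univ isOpen_univ⟩
    exact LorentzianMetric.mem_chronologicalFuture_of_hasPastEndpoint τ le_rfl hs hγ hz ht₁ ht₀ ht₁₀
  have hzS := mem_initialBoundary_of_entry 𝒱 M p B Φ hCX hzcl hzG (hγG t₀ ht₀) hzy
  exact causalPast_inter_closure_subset_of_mem_initialBoundary 𝒱 M p B Φ hCX hzS (hγG t₀ ht₀) hzy

end Development

end KillingPropagation

open KillingPropagation in
/-- **β' modulo the named facts and the bricks (G3), (G4)** — registered helper stub
`stub_killingPropagation'_of_facts` of the crux item: Killing PROPAGATION from a neighbourhood of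
the initial boundary `C ∪ N_out` of the Killing domain of an exact thick Kerr collar core into the
interior `(killingDomain)°`, anchored to `dΨ(Λe₀)` on the exact diamond, from (G3)
`stub_exactStarChartKilling`, (G4) `stub_killingFieldOn_eqOn_of_isPreconnected`,
`Literature.Geometry.Lorentzian.fischerMarsdenMoncrief_killing_development` (Moncrief 1975, §III;
Fischer–Marsden–Moncrief 1980, Lemma 2.2) and
`Literature.Geometry.Lorentzian.geroch1970_exists_isCauchyHypersurface` (Geroch 1970, Thm. 11):
the conditional closer `stub_killingPropagation'_of_facts'` with its hypothesis (H) discharged by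
`causalPast_inter_closure_subset_of_entry`. [cite: Moncrief1975, §III] [cite: HawkingEllis1973CUP, §6.5] -/
theorem stub_killingPropagation'_of_facts : (∀ (𝒮 : Spacetime.{0} 4) [𝒮.metric.toPseudoRiemannianMetric.HasLeviCivita] (M a : ℝ), 0 < M → |a| < M → ∀ (mo : lorentzGroup × E4) (B : ModelBackground), B = starBackground mo.1 mo.2 M a (fun x => Kerr.radius a (poincareInv mo.1 mo.2 x)) → ∀ (O : Set B.domain) (Ψ : B.domain → 𝒮.carrier), IsOpen O → ContMDiffOn 𝓘(ℝ, E4) (𝓡 4) ∞ Ψ O → IsOpenEmbedding (O.restrict Ψ) → supCkENorm (Subtype.val '' O) 0 (𝒮.deviationExtend B Ψ) ≤ 0 → ∃ ζ : Π y : 𝒮.carrier, TangentSpace (𝓡 4) y, 𝒮.metric.IsKillingFieldOn ζ (Ψ '' O) ∧ ∀ x ∈ O, ζ (Ψ x) = mfderiv 𝓘(ℝ, E4) (𝓡 4) Ψ x ((mo.1 : E4 ≃L[ℝ] E4) (E4.basisVector 0))) → (∀ (𝒮 : Spacetime.{0} 4) [𝒮.metric.toPseudoRiemannianMetric.HasLeviCivita]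 (A W : Set 𝒮.carrier) (ξ₁ ξ₂ : Π y : 𝒮.carrier, TangentSpace (𝓡 4) y), IsOpen A → IsPreconnected A → IsOpen W → W ⊆ A → W.Nonempty → 𝒮.metric.IsKillingFieldOn ξ₁ A → 𝒮.metric.IsKillingFieldOn ξ₂ A → (∀ y ∈ W, ξ₁ y = ξ₂ y) → ∀ y ∈ A, ξ₁ y = ξ₂ y) → Literature.Geometry.Lorentzian.fischerMarsdenMoncrief_killing_development → Literature.Geometry.Lorentzian.geroch1970_exists_isCauchyHypersurface → ∀ (X : Type) [TopologicalSpace X] [ChartedSpace E3 X] [IsManifold (𝓡 3) ∞ X] [T2Space X] [SecondCountableTopology X] [ConnectedSpace X] (D : InitialDataSet (𝓡 3) X) (𝒱 : VacuumCauchyDevelopment D) (M a : Fin 1 → ℝ) (p : 𝒱.carrier) (mo : Fin 1 → lorentzGroup × E4) (B : Fin 1 → ModelBackground) (Φ : ∀ i, (B i).domain → 𝒱.carrier) (Ψ : (B 0).domain → 𝒱.carrier) (V : Set 𝒱.carrier) (ξ : Π x : 𝒱.carrier, TangentSpace (𝓡 4) x), 0 < M 0 → |a 0| < M 0 → B 0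 = starBackground (mo 0).1 (mo 0).2 (M 0) (a 0) (fun x => Kerr.radius (a 0) (poincareInv (mo 0).1 (mo 0).2 x)) → p ∈ Φ 0 '' (B 0).truncTimeSlab (3 * M 0) 0 → (ContMDiffOn 𝓘(ℝ, E4) (𝓡 4) ∞ (Φ 0) {x | -1 < (B 0).time x.1 ∧ (B 0).time x.1 < 1 ∧ (B 0).radius x.1 < 3 * M 0 + 1} ∧ IsOpenEmbedding ({x | -1 < (B 0).time x.1 ∧ (B 0).time x.1 < 1 ∧ (B 0).radius x.1 < 3 * M 0 + 1}.restrict (Φ 0))) → collarCore M p B Φ ⊆ range 𝒱.embed → (∀ x ∈ (B 0).truncTimeSlab (3 * M 0) 0, Ψ x = Φ 0 x) → ContinuousOn Ψ (F1Route.slabDiamondWithSlab' (B 0) (M 0)) → ContMDiffOn 𝓘(ℝ, E4) (𝓡 4) ∞ Ψ (F1Route.slabDiamond' (B 0) (M 0)) → IsOpenEmbedding ((F1Route.slabDiamond' (B 0) (M 0)).restrict Ψ) → Ψ '' F1Route.slabDiamond' (B 0) (M 0) ⊆ interior (killingDomain 𝒱 M p B Φ) → supCkENorm (Subtype.val ''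 F1Route.slabDiamond' (B 0) (M 0)) 0 (𝒱.toSpacetime.deviationExtend (B 0) Ψ) ≤ 0 → ∀ [𝒱.metric.toPseudoRiemannianMetric.HasLeviCivita], IsOpen V → (collarCore M p B Φ ∪ (frontier (𝒱.metric.causalFuture 𝒱.timeOrientation (collarCore M p B Φ)) ∩ 𝒱.metric.causalFuture 𝒱.timeOrientation (Φ 0 '' shellSlab (B 0) (M 0)))) ⊆ V → 𝒱.metric.IsKillingFieldOn ξ (interior (killingDomain 𝒱 M p B Φ) ∩ V) → (∃ x ∈ F1Route.slabDiamond' (B 0) (M 0), Ψ x ∈ V) → (∀ x ∈ F1Route.slabDiamond' (B 0) (M 0), Ψ x ∈ V → ξ (Ψ x) = mfderiv 𝓘(ℝ, E4) (𝓡 4) Ψ x (((mo 0).1 : E4 ≃L[ℝ] E4) (E4.basisVector 0))) → ∃ ξ' : Π x : 𝒱.carrier, TangentSpace (𝓡 4) x, 𝒱.metric.IsKillingFieldOn ξ' (interior (killingDomain 𝒱 M p B Φ)) ∧ ∀ x ∈ F1Route.slabDiamond' (B 0) (M 0), ξ' (Ψ x) = mfderiv 𝓘(ℝ, E4) (𝓡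 4) Ψ x (((mo 0).1 : E4 ≃L[ℝ] E4) (E4.basisVector 0)) :=
  fun hG3 hG4 hFMM hSplit ↦ stub_killingPropagation'_of_facts' hG3 hG4 hFMM hSplit
    fun _ _ _ _ _ _ _ _ 𝒱 M p B Φ _ _ _ hCX hs hne hγ hγG hz hzG _ ↦
      causalPast_inter_closure_subset_of_entry 𝒱 M p B Φ hCX hs hne hγ hγG hz hzG

end Summit.FinalStateConjecture.FinalStateConjecture.Theorems.BondiBartnikRigidity.DirectMethod

end
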